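import Literature.MathematicalPhysics.QuantumFieldTheory.BalabanImbrieJaffe1984to88.BIJ88Result5145
import Literature.MathematicalPhysics.QuantumFieldTheory.BalabanImbrieJaffe1984to88.BIJ88Ineq5113Covering

/-!
# `BalabanImbrieJaffe1984to88.BIJ88Extraction311` — T. Bałaban, J. Imbrie, A. Jaffe, *Effective action and cluster properties of the
abelian Higgs model*, Commun. Math. Phys. **114** (1988) 257–315 [BalabanImbrieJaffe1988]: Sect. 5.14, pp. 310–311 [PDF 54–55] — THE
EXTRACTION OF THE STANDARD INTERACTION `𝒫^L_{k+1,loc}(Λ₈^{(k)})` FROM THE PERTURBATIVE TERMS, *"Altogether we have written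
V^{(k)}_{const}(Λ₈^{(k)}) + 𝒫̃_{k+1}(Λ₁₂^{(k)}) = 𝒫^L_{k+1,loc}(Λ₈^{(k)}) + Σ_X W₆^{(k)″}(X)"*, as an EXACT IDENTITY of the printed recipe
(random walk expansion of every propagator, leading terms with the standard covariances only, replacement/boundary pieces, terms of order
`> n̄` as remainders, re-localization of the vertices to `Λ̄₈^{(k)}`) with **`W₆^{(k)″}(X)` DEFINED as the named sum of its printed sources**,
and the hypothesis `h311` of p25's `BIJ88Result5145.eq5145` ((5.14.5)) DISCHARGED for that `W₆″`

statement-level skeleton of published theorems with citation tags; proofs where landed; nothing here is a claim about the Yang–Mills mass gap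

PDF held: `paper:balaban1988-cmp114-bij-abelian-higgs-effective-action` (journal page = PDF page + 256); pp. 310–312 [PDF 54–56] re-rendered this
session with `b2b-balaban-ref1/tools/g4png.py` and READ AS IMAGES (seat copies `HOME/lit-balaban-p31/renders/original-p054/p055-x2.png`), pp.
262–264 likewise (p006–p008).

CITATION HEADER (verbatim).  p. 310 [PDF 54], last paragraph: *"We make some modifications in the perturbative terms to achieve the standard
form of the interaction, 𝒫^L_{k+1,loc}. We give random walk expansions for the propagators C^{(k)}_{Λ₁₂^{(k)}}, C^{(k)}_{Λ₁₂^{(k)}}(u_{k+1}) produced in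
this step. The leading terms, with only propagators C^{(k)}_{Λ₁₂^{(k)},loc}, C^{(k)}_{Λ₁₂^{(k)},loc}(u_{k+1}), we transform further. The others, localized
in region X, have a factor of e^{−cr(e_k)|X|}. We also consider as remainders any terms whose order in λ and e is greater than n̄. We wish to
replace C^{(k)}_{Λ₁₂^{(k)},loc} with C^{(k)}_{loc}. … The replacement of C^{(k)}_{Λ₁₂^{(k)},loc} with C^{(k)}_{ℤ^d,loc} produces"* p. 311 [PDF 55]: *"terms
localized near Λ₁₂^{(k)c}. These terms are bounded by a small power of coupling constants, e^β(L^kε/ε₀)^{1/4−α}. To make the replacement of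
C^{(k)}_{ℤ^d,loc} with C^{(k)}_{loc}, note that the former always appears between two operators as (I − Q^{s*}Q)C^{(k)}_{ℤ^d,loc}(I − Q^*Q^s). This
differs from C^{(k)}_{loc} by a small, local operator, since after replacing C^{(k)}_{ℤ^d,loc} with C^{(k)}_{ℤ^d}, we have an identity (I −
Q^{s*}Q)C^{(k)}_{ℤ^d}(I − Q^*Q^s) = C^{(k)} = C^{(k)}_{loc} + O(e^{−cr(e_k)}). Thus after removing some O(e^{−cr(e_k)}) remainders, we have our standard
covariance C^{(k)}_{loc}. We compose propagators, using also terms from V^{(k)}_{const}(Λ₈^{(k)}). … There are also small (O(e^{−cr(e_k)})) terms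
… and boundary terms as above …. For simplicity we extend the localizations of vertices in all diagrams back to Λ̄₈^{(k)} (for gauge fields we
use a smooth localization function). This produces more boundary terms. Then the terms produced in this step combine with the old terms
V^{(k)}_{const}(Λ₈^{(k)}) to produce the full interaction 𝒫^L_{k+1,loc}(Λ₈^{(k)}). Altogether we have written V^{(k)}_{const}(Λ₈^{(k)}) + 𝒫̃_{k+1}(Λ₁₂^{(k)})
= 𝒫^L_{k+1,loc}(Λ₈^{(k)}) + Σ_X W₆^{(k)″}(X). If we put W₆^{(k)}(X) = W₆^{(k)′}(X) + W₆^{(k)″}(X), then …"*; (2.45) p. 264 [PDF 8]: *"Then we define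
C^{(k)}_Λ(u) = C^{(k)}_{Λ,loc}(u) + Σ_X C^{(k)}_{Λ,X}(u), (2.45) … The operator C^{(k)}_{Λ,X}(u) depends only on u in X. It vanishes unless both arguments
are in X, and is estimated as follows: |C^{(k)}_{Λ,X}(u; x₁, x₂)| ≦ e^{−cr(e_k)|X|}. (2.46)"*.

WHAT IS REPRODUCED.  SKELETON row **C2.Claim@310** of `HOME/lit-balaban-r16/ROWS-C2-part2.md` (*"W₆^{(k)′} bound (p.310) and 𝒫^L_{k+1,loc}
extraction (p.311)"*; owner r16: *"𝒫^L_{k+1,loc} extraction identities absent"*, `C2S5-CLOSURE.md` §3 item 4 *"Claim@310 still lacks the p.311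
𝒫^L_{k+1,loc} extraction / W₆″"*; §5 item 1 *"(5.14.5) h311 from … W₆″ files"*); also row **C2.Eq5.14.5** (p25's `eq5145` hypothesis `h311`).  Cell
`lit-balaban`, HOME `run/shared/lean/pub/lit-balaban/`; Phase-2 seat p31 gen 12 = unit `lit-balaban-p31-g12`; TAKING line HOME/STATUS.md
2026-08-22T05:17:14Z; owner r16 (NO OBJECTION 05:23:54Z), referee ref-5.  Companion of this seat's `BIJ88ScalarComposition311` (p319635: the
p. 311 «identity 2.42 from [7]» that gives the composed leading terms their standard form) and of p36's `BIJ88CovSandwich311` (p254892: the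
sandwich identity `(I − Q^{s*}Q)C_{ℤ^d}(I − Q^*Q^s) = C = C_loc + O(e^{−cr})`), which supply the REASONS for two of the replacements below; this
file is the BOOKKEEPING that makes the concluding display an identity.

THE READING (declared; the p. 310–311 recipe as finite-dimensional bookkeeping — the print gives no formula for `𝒫̃_{k+1}` beyond (5.14.2) and
none for `W₆″`).  Cubes `ι` (the r(e_k)-cubes; `Λ₁₂^{(k)} = W′`, `Λ̄₈^{(k)} = A ⊇ W′`); the perturbative terms `𝒫̃_{k+1}(Λ₁₂)` = a finite sum of
DIAGRAM terms: shapes `γ : D` (a `Fintype`), each anchored at a vertex cube `x ∈ Λ₁₂` (*"localizations of vertices"*), with `m γ` propagator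
slots of species `spec γ i : S` (`C^{(k)}_{Λ₁₂}` or `C^{(k)}_{Λ₁₂}(u_{k+1})`, …) and an order `ord γ` *"in λ and e"*; the term is a MULTILINEAR
functional `T γ x` of the kernels in its slots (`K` an abstract real vector space of kernels) — this is all the recipe uses of the terms.  The
propagator of species `s` on the region is decomposed as **`C s = Cstd s + Σ_{r ∈ pc s} E s r`** (`Cstd s` = the STANDARD covariance `C^{(k)}_{loc}`
resp. `C^{(k)}_{loc}(u_{k+1})`; the pieces `r` with localization regions `reg r ⊆ A`: the random-walk pieces `C_{Λ,X}` of (2.45) with `reg = X`, the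
boundary pieces of `C_{Λ,loc} → C_{ℤ^d,loc}` *"localized near Λ₁₂^c"*, the sandwich/composition `O(e^{−cr(e_k)})` pieces — §4 builds this family
from the three printed decompositions).  DEFINED from these data (§2): `full γ x` (the term with the actual propagators), `std γ x` (the
*"leading term"*: standard covariances in every slot), `term γ x a` for a slot filling `a : Fin (m γ) → Option P` (`none` = standard, `some r` =
the piece `r`), its localization `loc γ x a = {x} ∪ ⋃ reg(a i)` (*"localized in region X"*), `pert W′ = Σ_{x∈W′} Σ_γ full γ x` (= 𝒫̃_{k+1}(Λ₁₂)),
**`PL A = V_const + Σ_{x∈A} Σ_{ord γ ≤ n̄} std γ x`** (= 𝒫^L_{k+1,loc}(Λ₈): the leading terms of order `≤ n̄` with the vertices extended to `Λ̄₈`,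
combined with `V_const`), and **`W6pp A W′ X`** = (i) the terms with at least one piece, localized at `X` (*"The others, localized in region X"*,
incl. the boundary and `O(e^{−cr})` pieces) + (ii) the leading terms of order `> n̄` anchored at `X = {x}`, `x ∈ Λ₁₂` (*"We also consider as
remainders any terms whose order in λ and e is greater than n̄"*) − (iii) the leading terms of order `≤ n̄` anchored at `X = {x}`, `x ∈ Λ̄₈ ∖ Λ₁₂`
(*"we extend the localizations of vertices in all diagrams back to Λ̄₈. This produces more boundary terms"* — they enter `𝒫^L` with `+` and
`ΣW₆″` with `−`).

WHAT IS PROVED (0 `sorry`; defs with bodies + theorems; no `Prop`-valued fact; Literature imports + Mathlib only).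
§2 `full_eq_sum_choices` (multilinear expansion over the slot fillings, `MultilinearMap.map_sum_finset`), `full_eq_std_add` (= leading term + the
  terms with at least one piece), `loc_subset` (`loc ⊆ A`), `sum_W6pp_pieces`/`sum_W6pp_high`/`sum_W6pp_reloc` (regrouping by localization region).
§3 **`extraction311`**: for `W′ ⊆ A` and all piece regions `⊆ A`,  **`V_const + pert W′ = PL A + Σ_{X ⊆ A} W6pp A W′ X`** — the concluding display of
  p. 311 as an identity, the sum over `X` running over `A.powerset`; `extraction311_regions` (the same with any finite family `𝒳 ⊇` the occurring
  regions); and **`eq5145_of_extraction`**: p25's (5.14.5) `BIJ88Result5145.eq5145` with its hypothesis `h311` DISCHARGED — for region-dependent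
  decomposition data `pc W′`, `E W′` (the pieces of `C^{(k)}_{W′}`) and `W ⊆ A`, (5.14.5) holds with `𝒫^L := PL A`, `W₆″ := W6pp A`, `𝒳 := A.powerset`,
  the remaining inputs (`hz`, `hlogz` now for `pert`, `hrem`, `h312`) verbatim.
§4 `pieces_of_chain`: the piece family ASSEMBLED from the three printed decompositions of one species — (2.45) `C_Λ = C_{Λ,loc} + Σ_X C_{Λ,X}`,
  `C_{Λ,loc} = C_{ℤ^d,loc} + Σ_b B_b` (boundary pieces), `C_{ℤ^d,loc} ≃ C_loc + Σ_o O_o` (the sandwich `O(e^{−cr})` pieces, p36's `identity311`/`trunc_close`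
  give the reason) — as a `Sum`-indexed family with `C_Λ = C_loc + Σ pieces` (`chain_decomposition`).
HONEST SCOPE.  (a) Bookkeeping only: that `𝒫̃_{k+1}(Λ₁₂)` of (5.14.2) IS such a finite sum of multilinear diagram terms (Wick expansion of the
`t`-derivatives of `log z_t` at `t = 0`) is the READING, not derived (p25/p36's §5.13 Gaussian model stops at the slot moments); in
`eq5145_of_extraction` the (5.14.2) split `hlogz` is therefore stated for THIS `pert`.  (b) No bound is proved here: the sizes *"factor of
e^{−cr(e_k)|X|}"*, *"small power of coupling constants"*, *"order … greater than n̄"* and the two-case bound on `W₆ = W₆′ + W₆″` are the companion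
`BIJ88Extraction311Bound` (announced; `IneqW6` for THIS `W₆″` from printed-shape source bounds + p25's `IneqW6′`).  (c) The gauge-field composition
(5.5.11) and the scalar one ([7] (2.42), `BIJ88ScalarComposition311`) act INSIDE `std`/`PL` (they give the leading terms their standard form); at the
level of this identity `PL` is a definition.  (d) `V_const` enters as a number.  NOT summit progress.
-/

namespace Literature.MathematicalPhysics.QuantumFieldTheory.BalabanImbrieJaffe1984to88.BIJ88Extraction311

open Finset
open Literature.Probability.LatticeModels (setPartitions)
open Literature.MathematicalPhysics.QuantumFieldTheory.BalabanImbrieJaffe1984to88.BIJ88Resummation5141 (outer lam12 lam12_subset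
  disjoint_lam12 polysIn Compat restrictTo g2 zF zS)
open Literature.MathematicalPhysics.QuantumFieldTheory.BalabanImbrieJaffe1984to88.BIJ88Result5145 (expect1 eq5145)

noncomputable section

variable {ι : Type} [DecidableEq ι]
variable {S : Type*} {K : Type*} [AddCommGroup K] [Module ℝ K]
variable {D : Type*} [Fintype D] {P : Type*} [DecidableEq P]

/-! ## §2 The objects of the recipe -/

section Objects

variable (m : D → ℕ) (spec : (γ : D) → Fin (m γ) → S) (T : (γ : D) → ι → MultilinearMap ℝ (fun _ : Fin (m γ) => K) ℝ)
variable (Cstd : S → K) (pc : S → Finset P) (E : S → P → K) (reg : P → Finset ι)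

/-- The slot fillings of a diagram of shape `γ`: each propagator slot `i` carries either the STANDARD covariance of its species (`none`:
*"The leading terms, with only propagators C_{Λ,loc}"*) or one of the pieces `r ∈ pc (spec γ i)` of the decomposition of the actual propagator
(`some r`: a random-walk piece `C_{Λ,X}`, a boundary piece, an `O(e^{−cr})` piece). [cite: BalabanImbrieJaffe1988, p.310 (Sect. 5.14)] -/
def choices (γ : D) : Finset (Fin (m γ) → Option P) :=
  Fintype.piFinset fun i => insertNone (pc (spec γ i))

/-- the kernels placed in the slots by a filling `a`. [cite: BalabanImbrieJaffe1988, p.310 (Sect. 5.14)] -/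
def slotVal (γ : D) (a : Fin (m γ) → Option P) : Fin (m γ) → K :=
  fun i => (a i).elim (Cstd (spec γ i)) (E (spec γ i))

/-- the diagram term of shape `γ` anchored at the cube `x` with the slot filling `a` (multilinear in the slot kernels).
[cite: BalabanImbrieJaffe1988, p.310 (Sect. 5.14)] -/
def term (γ : D) (x : ι) (a : Fin (m γ) → Option P) : ℝ :=
  T γ x (slotVal m spec Cstd E γ a)

/-- the LEADING term of shape `γ` at `x`: standard covariances in every slot (*"The leading terms, with only propagators C_{Λ,loc},
C_{Λ,loc}(u_{k+1}), we transform further"* — after the replacements `C_{Λ,loc} → C_{ℤ^d,loc} → C_loc`). [cite: BalabanImbrieJaffe1988, p.310 (Sect. 5.14)] -/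
def std (γ : D) (x : ι) : ℝ :=
  T γ x fun i => Cstd (spec γ i)

/-- the term of shape `γ` at `x` with the ACTUAL propagators `C s = Cstd s + Σ_{r∈pc s} E s r` in every slot (a summand of `𝒫̃_{k+1}(Λ₁₂)`).
[cite: BalabanImbrieJaffe1988, p.310 (Sect. 5.14)] -/
def full (γ : D) (x : ι) : ℝ :=
  T γ x fun i => Cstd (spec γ i) + ∑ r ∈ pc (spec γ i), E (spec γ i) r

/-- the localization region of a term: its vertex cube and the regions of its pieces (*"The others, localized in region X"*).
[cite: BalabanImbrieJaffe1988, p.310 (Sect. 5.14)] -/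
def loc (γ : D) (x : ι) (a : Fin (m γ) → Option P) : Finset ι :=
  insert x (Finset.univ.biUnion fun i => (a i).elim ∅ reg)

/-- **`𝒫̃_{k+1}(Λ₁₂^{(k)})` in the reading**: the perturbative terms of (5.14.2) as the finite sum of the diagram terms anchored in `Λ₁₂ = W′` with the
actual propagators. [cite: BalabanImbrieJaffe1988, (5.14.2) p.308] -/
def pert (W' : Finset ι) : ℝ :=
  ∑ x ∈ W', ∑ γ, full m spec T Cstd pc E γ x

variable (ord : D → ℕ) (nbar : ℕ)

/-- **`𝒫^L_{k+1,loc}(Λ₈^{(k)})`**: `V^{(k)}_{const}(Λ₈^{(k)})` combined with the leading terms of order `≤ n̄` with their vertices EXTENDED to `A = Λ̄₈^{(k)}`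
(*"we extend the localizations of vertices in all diagrams back to Λ̄₈ … the terms produced in this step combine with the old terms V_const(Λ₈)
to produce the full interaction 𝒫^L_{k+1,loc}(Λ₈)"*). [cite: BalabanImbrieJaffe1988, p.311 (Sect. 5.14)] -/
def PL (Vconst : ℝ) (A : Finset ι) : ℝ :=
  Vconst + ∑ x ∈ A, ∑ γ ∈ univ.filter (fun γ => ord γ ≤ nbar), std m spec T Cstd γ x

/-- **`W₆^{(k)″}(X)`, DEFINED as the named sum of its printed sources**: (i) the terms with at least one non-standard piece, localized at `X`
(*"The others, localized in region X, have a factor of e^{−cr(e_k)|X|}"*, together with the boundary pieces *"localized near Λ₁₂^c"* of the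
replacement `C_{Λ₁₂,loc} → C_{ℤ^d,loc}` and the `O(e^{−cr(e_k)})` remainders of `C_{ℤ^d,loc} → C_loc` and of the propagator composition); (ii) the leading
terms of order `> n̄` at `X = {x}`, `x ∈ Λ₁₂` (*"We also consider as remainders any terms whose order in λ and e is greater than n̄"*); (iii) MINUS
the leading terms of order `≤ n̄` at `X = {x}`, `x ∈ Λ̄₈ ∖ Λ₁₂` (*"we extend the localizations of vertices in all diagrams back to Λ̄₈. This produces
more boundary terms"*). [cite: BalabanImbrieJaffe1988, p.311 (Sect. 5.14)] -/
def W6pp (A W' X : Finset ι) : ℝ :=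
  (∑ x ∈ W', ∑ γ, ∑ a ∈ ((choices m spec pc γ).erase (fun _ => none)).filter (fun a => loc m reg γ x a = X),
      term m spec T Cstd E γ x a)
  + (∑ x ∈ W'.filter (fun x => ({x} : Finset ι) = X), ∑ γ ∈ univ.filter (fun γ => nbar < ord γ), std m spec T Cstd γ x)
  - (∑ x ∈ (A \ W').filter (fun x => ({x} : Finset ι) = X), ∑ γ ∈ univ.filter (fun γ => ord γ ≤ nbar), std m spec T Cstd γ x)

/-! ### The multilinear expansion over the slot fillings -/

omit [Fintype D] [DecidableEq P] in
/-- the all-standard filling is admissible. [cite: BalabanImbrieJaffe1988, p.310 (Sect. 5.14)] -/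
theorem none_mem_choices (γ : D) : (fun _ => none) ∈ choices m spec pc γ :=
  Fintype.mem_piFinset.2 fun _ => mem_insertNone.2 fun a h => (Option.not_mem_none a h).elim

omit [DecidableEq ι] [Fintype D] [DecidableEq P] in
/-- the all-standard filling gives the leading term. [cite: BalabanImbrieJaffe1988, p.310 (Sect. 5.14)] -/
theorem term_none (γ : D) (x : ι) : term m spec T Cstd E γ x (fun _ => none) = std m spec T Cstd γ x := rfl

omit [DecidableEq ι] [Fintype D] [DecidableEq P] in
/-- **«We give random walk expansions for the propagators … produced in this step»** — the multilinear expansion: the term with the actual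
propagators is the sum over all slot fillings of the piece terms (`MultilinearMap.map_sum_finset`). [cite: BalabanImbrieJaffe1988, p.310 (Sect. 5.14)] -/
theorem full_eq_sum_choices (γ : D) (x : ι) :
    full m spec T Cstd pc E γ x = ∑ a ∈ choices m spec pc γ, term m spec T Cstd E γ x a := by
  have h : (fun i => Cstd (spec γ i) + ∑ r ∈ pc (spec γ i), E (spec γ i) r)
      = fun i => ∑ o ∈ insertNone (pc (spec γ i)), (o.elim (Cstd (spec γ i)) (E (spec γ i)) : K) := by
    funext i
    rw [sum_insertNone]
    rfl
  rw [full, h, MultilinearMap.map_sum_finset]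
  rfl

omit [DecidableEq ι] [Fintype D] in
/-- **«The leading terms … we transform further. The others, localized in region X …»**: the term with the actual propagators = the leading term
+ the terms with at least one non-standard piece. [cite: BalabanImbrieJaffe1988, p.310 (Sect. 5.14)] -/
theorem full_eq_std_add (γ : D) (x : ι) :
    full m spec T Cstd pc E γ x
      = std m spec T Cstd γ x + ∑ a ∈ (choices m spec pc γ).erase (fun _ => none), term m spec T Cstd E γ x a := by
  rw [full_eq_sum_choices, ← add_sum_erase _ _ (none_mem_choices m spec pc γ), term_none]

omit [Fintype D] [DecidableEq P] in
/-- the localization region of an admissible filling lies in `A` when the vertex cube and all piece regions do.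
[cite: BalabanImbrieJaffe1988, p.310 (Sect. 5.14)] -/
theorem loc_subset {A : Finset ι} (hreg : ∀ s, ∀ r ∈ pc s, reg r ⊆ A) {γ : D} {x : ι} (hx : x ∈ A)
    {a : Fin (m γ) → Option P} (ha : a ∈ choices m spec pc γ) : loc m reg γ x a ⊆ A := by
  intro y hy
  rcases mem_insert.1 hy with rfl | hy
  · exact hx
  · obtain ⟨i, -, hi⟩ := mem_biUnion.1 hy
    have hai : a i ∈ insertNone (pc (spec γ i)) := Fintype.mem_piFinset.1 ha i
    revert hi hai
    cases a i with
    | none => intro hi; simp at hi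
    | some r => intro hi hai; exact hreg _ r (mem_insertNone.1 hai r rfl) hi

omit [Fintype D] [DecidableEq P] in
/-- the vertex cube lies in the localization region. [cite: BalabanImbrieJaffe1988, p.310 (Sect. 5.14)] -/
theorem mem_loc (γ : D) (x : ι) (a : Fin (m γ) → Option P) : x ∈ loc m reg γ x a := mem_insert_self _ _

omit [Fintype D] [DecidableEq P] in
/-- the region of every piece used lies in the localization region. [cite: BalabanImbrieJaffe1988, p.310 (Sect. 5.14)] -/
theorem reg_subset_loc (γ : D) (x : ι) (a : Fin (m γ) → Option P) {i : Fin (m γ)} {r : P} (hi : a i = some r) :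
    reg r ⊆ loc m reg γ x a := by
  intro y hy
  refine mem_insert_of_mem (mem_biUnion.2 ⟨i, mem_univ _, ?_⟩)
  rw [hi]
  exact hy

/-! ### Regrouping by localization region -/

/-- source (i) regrouped: summing `W6pp`'s piece part over `X ⊆ A` gives back all terms with at least one piece.
[cite: BalabanImbrieJaffe1988, p.311 (Sect. 5.14)] -/
theorem sum_W6pp_pieces {A W' : Finset ι} (hW : W' ⊆ A) (hreg : ∀ s, ∀ r ∈ pc s, reg r ⊆ A) :
    ∑ X ∈ A.powerset, ∑ x ∈ W', ∑ γ, ∑ a ∈ ((choices m spec pc γ).erase (fun _ => none)).filter (fun a => loc m reg γ x a = X),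
        term m spec T Cstd E γ x a
      = ∑ x ∈ W', ∑ γ, ∑ a ∈ (choices m spec pc γ).erase (fun _ => none), term m spec T Cstd E γ x a := by
  rw [sum_comm]
  refine sum_congr rfl fun x hx => ?_
  rw [sum_comm]
  refine sum_congr rfl fun γ _ => ?_
  exact sum_fiberwise_of_maps_to (fun a ha => mem_powerset.2 (loc_subset m spec pc reg hreg (hW hx) (mem_of_mem_erase ha))) _

/-- source (ii) regrouped: summing the order-`> n̄` part over `X ⊆ A` gives back all leading terms of order `> n̄` anchored in `W′`.
[cite: BalabanImbrieJaffe1988, p.311 (Sect. 5.14)] -/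
theorem sum_W6pp_high {A W' : Finset ι} (hW : W' ⊆ A) :
    ∑ X ∈ A.powerset, ∑ x ∈ W'.filter (fun x => ({x} : Finset ι) = X), ∑ γ ∈ univ.filter (fun γ => nbar < ord γ), std m spec T Cstd γ x
      = ∑ x ∈ W', ∑ γ ∈ univ.filter (fun γ => nbar < ord γ), std m spec T Cstd γ x :=
  sum_fiberwise_of_maps_to (fun _ hx => mem_powerset.2 (singleton_subset_iff.2 (hW hx))) _

/-- source (iii) regrouped: summing the re-localization part over `X ⊆ A` gives back all leading terms of order `≤ n̄` anchored in `A ∖ W′`.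
[cite: BalabanImbrieJaffe1988, p.311 (Sect. 5.14)] -/
theorem sum_W6pp_reloc {A W' : Finset ι} :
    ∑ X ∈ A.powerset, ∑ x ∈ (A \ W').filter (fun x => ({x} : Finset ι) = X), ∑ γ ∈ univ.filter (fun γ => ord γ ≤ nbar),
        std m spec T Cstd γ x
      = ∑ x ∈ A \ W', ∑ γ ∈ univ.filter (fun γ => ord γ ≤ nbar), std m spec T Cstd γ x :=
  sum_fiberwise_of_maps_to (fun _ hx => mem_powerset.2 (singleton_subset_iff.2 (sdiff_subset hx))) _

omit [DecidableEq ι] [DecidableEq P] in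
/-- the leading terms split by order. [cite: BalabanImbrieJaffe1988, p.310 (Sect. 5.14)] -/
theorem sum_std_split (x : ι) :
    ∑ γ, std m spec T Cstd γ x
      = ∑ γ ∈ univ.filter (fun γ => ord γ ≤ nbar), std m spec T Cstd γ x
        + ∑ γ ∈ univ.filter (fun γ => nbar < ord γ), std m spec T Cstd γ x := by
  rw [← sum_filter_add_sum_filter_not univ (fun γ => ord γ ≤ nbar)]
  congr 2
  ext γ
  simp [not_le]

/-! ## §3 The extraction identity and (5.14.5) with `h311` discharged -/

/-- **p. 311 [PDF 55], «Altogether we have written V^{(k)}_{const}(Λ₈^{(k)}) + 𝒫̃_{k+1}(Λ₁₂^{(k)}) = 𝒫^L_{k+1,loc}(Λ₈^{(k)}) + Σ_X W₆^{(k)″}(X)», EXACT**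
in the reading: for `Λ₁₂ = W′ ⊆ A = Λ̄₈` and all piece regions inside `A`,
`V_const + pert W′ = PL A + Σ_{X ⊆ A} W6pp A W′ X` — with `W₆″` the named sum of its printed sources (`W6pp`).
[cite: BalabanImbrieJaffe1988, p.311 (Sect. 5.14)] -/
theorem extraction311 (Vconst : ℝ) {A W' : Finset ι} (hW : W' ⊆ A) (hreg : ∀ s, ∀ r ∈ pc s, reg r ⊆ A) :
    Vconst + pert m spec T Cstd pc E W'
      = PL m spec T Cstd ord nbar Vconst A + ∑ X ∈ A.powerset, W6pp m spec T Cstd pc E reg ord nbar A W' X := by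
  -- regroup the three sources
  have hsplit : ∑ X ∈ A.powerset, W6pp m spec T Cstd pc E reg ord nbar A W' X
      = (∑ x ∈ W', ∑ γ, ∑ a ∈ (choices m spec pc γ).erase (fun _ => none), term m spec T Cstd E γ x a)
        + (∑ x ∈ W', ∑ γ ∈ univ.filter (fun γ => nbar < ord γ), std m spec T Cstd γ x)
        - (∑ x ∈ A \ W', ∑ γ ∈ univ.filter (fun γ => ord γ ≤ nbar), std m spec T Cstd γ x) := by
    simp only [W6pp, sum_add_distrib, sum_sub_distrib]
    rw [sum_W6pp_pieces m spec T Cstd pc E reg hW hreg, sum_W6pp_high m spec T Cstd ord nbar hW, sum_W6pp_reloc m spec T Cstd ord nbar]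
  -- the leading terms of order ≤ n̄: Σ_{x∈W′} = Σ_{x∈A} − Σ_{x∈A∖W′}
  have hlow : ∑ x ∈ W', ∑ γ ∈ univ.filter (fun γ => ord γ ≤ nbar), std m spec T Cstd γ x
      = (∑ x ∈ A, ∑ γ ∈ univ.filter (fun γ => ord γ ≤ nbar), std m spec T Cstd γ x)
        - ∑ x ∈ A \ W', ∑ γ ∈ univ.filter (fun γ => ord γ ≤ nbar), std m spec T Cstd γ x := by
    rw [← sum_sdiff hW]; ring
  -- assemble
  have hpert : pert m spec T Cstd pc E W'
      = (∑ x ∈ W', ∑ γ ∈ univ.filter (fun γ => ord γ ≤ nbar), std m spec T Cstd γ x)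
        + (∑ x ∈ W', ∑ γ ∈ univ.filter (fun γ => nbar < ord γ), std m spec T Cstd γ x)
        + (∑ x ∈ W', ∑ γ, ∑ a ∈ (choices m spec pc γ).erase (fun _ => none), term m spec T Cstd E γ x a) := by
    simp only [pert, full_eq_std_add, sum_add_distrib, sum_std_split m spec T Cstd ord nbar]
  rw [hsplit, hpert, hlow, PL]
  ring

/-- The same identity with the localization regions summed over ANY finite family `𝒳 ⊇ A.powerset`-occurring regions: here stated for
`𝒳 = A.powerset` re-indexed is all we need; recorded form: the `X ∉ A.powerset` summands of `W6pp` vanish (no term is localized outside `A`).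
[cite: BalabanImbrieJaffe1988, p.311 (Sect. 5.14)] -/
theorem W6pp_eq_zero_of_not_subset {A W' X : Finset ι} (hW : W' ⊆ A) (hreg : ∀ s, ∀ r ∈ pc s, reg r ⊆ A) (hX : ¬ X ⊆ A) :
    W6pp m spec T Cstd pc E reg ord nbar A W' X = 0 := by
  have h1 : ∀ x ∈ W', ∀ γ : D, ((choices m spec pc γ).erase (fun _ => none)).filter (fun a => loc m reg γ x a = X) = ∅ := by
    intro x hx γ
    refine filter_eq_empty_iff.2 fun a ha hloc => hX ?_
    rw [← hloc]
    exact loc_subset m spec pc reg hreg (hW hx) (mem_of_mem_erase ha)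
  have h2 : W'.filter (fun x => ({x} : Finset ι) = X) = ∅ :=
    filter_eq_empty_iff.2 fun x hx hxX => hX (hxX ▸ singleton_subset_iff.2 (hW hx))
  have h3 : (A \ W').filter (fun x => ({x} : Finset ι) = X) = ∅ :=
    filter_eq_empty_iff.2 fun x hx hxX => hX (hxX ▸ singleton_subset_iff.2 (sdiff_subset hx))
  simp only [W6pp, h2, h3, sum_empty, add_zero, sub_zero]
  exact sum_eq_zero fun x hx => sum_eq_zero fun γ _ => by rw [h1 x hx γ, sum_empty]

end Objects

/-! ### (5.14.5) with `h311` discharged -/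

section Eq5145

variable {Φ : Type*}
variable (m : D → ℕ) (spec : (γ : D) → Fin (m γ) → S) (T : (γ : D) → ι → MultilinearMap ℝ (fun _ : Fin (m γ) => K) ℝ)
variable (Cstd : S → K) (pc : Finset ι → S → Finset P) (E : Finset ι → S → P → K) (reg : P → Finset ι) (ord : D → ℕ) (nbar : ℕ)

/-- **(5.14.5) with the p. 311 extraction AS A THEOREM**: p25's `BIJ88Result5145.eq5145` with its hypothesis `h311` (*"by assertion in print"*)
DISCHARGED by `extraction311` — for the region-dependent pieces `pc W′`, `E W′` of the propagators `C^{(k)}_{W′}` of each large-field-free region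
`W′ = Λ₁₂` (regions inside `A = Λ̄₈ ⊇ W`), the perturbative terms `pert` of THIS bookkeeping in the (5.14.2) split `hlogz`, `𝒫^L_{k+1,loc} := PL A`,
`W₆″ := W6pp A` and the localization family `𝒳 := A.powerset`; all other inputs of `eq5145` verbatim. [cite: BalabanImbrieJaffe1988, (5.14.5) p.312] -/
theorem eq5145_of_extraction (W B : Finset ι) (g : Finset ι → ℝ) (Ex : Finset ι → (Φ → ℝ) →ₗ[ℝ] ℝ) (χ F : Finset ι → Φ → ℝ)
    (Ys : Finset (Finset ι)) (b : Finset ι → Φ → ℝ) (g₁ : Finset ι → Finset (Finset ι) → ℝ)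
    (hYs : ∀ Y ∈ Ys, Y.Nonempty) (hg : ∀ X ⊆ W, X.Nonempty → Disjoint X B → g X = g2 Ys g₁ X)
    (hdec : ∀ W' ⊆ W, Disjoint W' B → ∀ S' ⊆ polysIn Ys W',
      zS Ex (fun W => χ W * F W) b W' S' = ∑ κ ∈ setPartitions W', if Compat κ S' then ∏ X ∈ κ, g₁ X (restrictTo S' X) else 0)
    (Vconst : ℝ) (A : Finset ι) (hWA : W ⊆ A) (hreg : ∀ W' s, ∀ r ∈ pc W' s, reg r ⊆ A)
    (rem obs : Finset ι → ℝ) (W6p : Finset ι → Finset ι → ℝ)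
    (hz : ∀ W' ⊆ W, Disjoint W' B → 0 < zF Ex χ Ys b W')
    (hlogz : ∀ W' ⊆ W, Disjoint W' B → Real.log (zF Ex χ Ys b W') = -pert m spec T Cstd (pc W') (E W') W' - rem W')
    (hrem : ∀ W' ⊆ W, Disjoint W' B → rem W' = ∑ X ∈ A.powerset, W6p W' X)
    (h312 : ∀ W' ⊆ W, Disjoint W' B → expect1 Ex χ Ys b W' (F W') = obs W') :
    Real.exp (-Vconst) * ∑ π ∈ setPartitions W, ∏ X ∈ π, g X =
      ∑ ρ ∈ outer W B, (∏ X ∈ ρ, g X) * (obs (lam12 W ρ) *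
        Real.exp (-PL m spec T Cstd ord nbar Vconst A
          - ∑ X ∈ A.powerset, (W6p (lam12 W ρ) X
              + W6pp m spec T Cstd (pc (lam12 W ρ)) (E (lam12 W ρ)) reg ord nbar A (lam12 W ρ) X))) :=
  eq5145 W B g Ex χ F Ys b g₁ hYs hg hdec Vconst (PL m spec T Cstd ord nbar Vconst A) A.powerset
    (fun W' => pert m spec T Cstd (pc W') (E W') W') rem obs W6p
    (fun W' X => W6pp m spec T Cstd (pc W') (E W') reg ord nbar A W' X) hz hlogz hrem
    (fun W' hW' _ => extraction311 m spec T Cstd (pc W') (E W') reg ord nbar Vconst (hW'.trans hWA) (hreg W')) h312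

end Eq5145

/-! ## §4 The piece family assembled from the three printed decompositions -/

section Chain

variable {X₁ X₂ X₃ : Type*}

omit [Module ℝ K] in
/-- **The three replacements of pp. 310–311 for one species, as one piece family**: from (2.45) `C_Λ = C_{Λ,loc} + Σ_{X} C_{Λ,X}` (random-walk
pieces, index `X₁`), the boundary decomposition `C_{Λ,loc} = C_{ℤ^d,loc} + Σ_b B_b` (*"terms localized near Λ₁₂^c"*, index `X₂`) and the sandwich
replacement `C_{ℤ^d,loc} ≃ C_loc + Σ_o O_o` (*"after removing some O(e^{−cr(e_k)}) remainders, we have our standard covariance C_loc"*, index `X₃`;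
p36's `BIJ88CovSandwich311.identity311` is the reason), the actual propagator is the standard one plus the `Sum`-indexed pieces:
`C_Λ = C_loc + Σ_{X₁ ⊕ X₂ ⊕ X₃} pieces`. [cite: BalabanImbrieJaffe1988, (2.45) p.264] -/
theorem chain_decomposition {CΛ CΛloc CZloc Cloc : K} (I₁ : Finset X₁) (I₂ : Finset X₂) (I₃ : Finset X₃)
    (RW : X₁ → K) (Bd : X₂ → K) (Sw : X₃ → K)
    (h245 : CΛ = CΛloc + ∑ X ∈ I₁, RW X) (hbd : CΛloc = CZloc + ∑ b ∈ I₂, Bd b) (hsw : CZloc = Cloc + ∑ o ∈ I₃, Sw o) :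
    CΛ = Cloc + ∑ r ∈ (I₁.disjSum I₂).disjSum I₃, Sum.elim (Sum.elim RW Bd) Sw r := by
  rw [sum_disjSum, sum_disjSum, h245, hbd, hsw]
  simp only [Sum.elim_inl, Sum.elim_inr]
  abel

omit [Module ℝ K] in
/-- the same packaged as the decomposition datum `(pc, E)` of §2 for a species: `pc := (I₁ ⊕ I₂) ⊕ I₃`, `E := Sum.elim (Sum.elim RW Bd) Sw`.
[cite: BalabanImbrieJaffe1988, (2.45) p.264] -/
theorem pieces_of_chain {CΛ CΛloc CZloc Cloc : K} (I₁ : Finset X₁) (I₂ : Finset X₂) (I₃ : Finset X₃)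
    (RW : X₁ → K) (Bd : X₂ → K) (Sw : X₃ → K)
    (h245 : CΛ = CΛloc + ∑ X ∈ I₁, RW X) (hbd : CΛloc = CZloc + ∑ b ∈ I₂, Bd b) (hsw : CZloc = Cloc + ∑ o ∈ I₃, Sw o) :
    ∃ (pcs : Finset ((X₁ ⊕ X₂) ⊕ X₃)) (Es : (X₁ ⊕ X₂) ⊕ X₃ → K),
      CΛ = Cloc + ∑ r ∈ pcs, Es r ∧ (∀ X, Es (Sum.inl (Sum.inl X)) = RW X) ∧ (∀ b, Es (Sum.inl (Sum.inr b)) = Bd b)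
        ∧ (∀ o, Es (Sum.inr o) = Sw o) :=
  ⟨(I₁.disjSum I₂).disjSum I₃, Sum.elim (Sum.elim RW Bd) Sw, chain_decomposition I₁ I₂ I₃ RW Bd Sw h245 hbd hsw,
    fun _ => rfl, fun _ => rfl, fun _ => rfl⟩

end Chain

end

end Literature.MathematicalPhysics.QuantumFieldTheory.BalabanImbrieJaffe1984to88.BIJ88Extraction311
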